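import Literature.Computability.AlgebraicComplexity.BorderRankMatMulSmall
import Literature.Computability.AlgebraicComplexity.BorderRankMatMulThreeSmirnov
import Literature.Computability.AlgebraicComplexity.MatMulBorderSubstitution
import Literature.Computability.AlgebraicComplexity.LandsbergMichalekKoszul
import HarnessLib

/-!
# `16 ≤ bR(⟨3,3,3⟩) ≤ 20` (Landsberg 2017, §1.1.14): the window for `3 × 3` matrices — proved

Topic `Literature/Computability/AlgebraicComplexity`. Theorems only (no definitions, no named facts).
This file DISCHARGES the named fact `LandsbergGCT2017_borderRank_matMulTensor_three` of
`BorderRankMatMulSmall.lean` — the sentence "For `n = 3`, we only know `16 ≤ R̲(M⟨3⟩) ≤ 20`" of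
J. M. Landsberg, *Geometry and Complexity Theory* (CUP 2017), §1.1.14, p. 20, read for the tree's
algebraic border rank `algBorderRank` over `ℂ[ε]` — by assembling pieces that are all proved in the
tree:

* **`≤ 20` (Smirnov 2013).** `Smirnov2013_algBorderRank_matMulTensor_three_le`
  (`BorderRankMatMulThreeSmirnov.lean`): Smirnov's explicit approximate algorithm with `20`
  multiplications, kernel-checked as an order-`6` approximate decomposition.
* **`16 ≤` (Landsberg–Michałek; Landsberg 2017, Thm. 5.4.5.1 = LM 2018, Thm. 1.1 with
  `n = w = 3`, `m = 1`: `2·9 − 3 + 1 − ⌊3·C(3,0)/C(4,2)⌋ = 16`).** Following the printed proof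
  (§5.4.5, Parts 1–2):
  - Part 1 with one killed direction (`matMul_exists_youngDiagram_algBorderRank_le`,
    `MatMulBorderSubstitution.lean`, resting on the border substitution method Prop. 5.4.1.3 over
    `K[ε]`, `BorderSubstitution(Torus).lean`): there is a one-cell Young diagram `λ` — necessarily the
    corner cell `(2, 0)` of the first factor `K^{3×3}` in the tree's coordinates — with
    `bR(⟨3,3,3⟩^λ) + 1 ≤ bR(⟨3,3,3⟩)` (`algBorderRank_delSlices_corner_matMulTensor_three`).
  - The `GL(U)`-symmetry reversing the row index carries the cell `(2,0)` to `(0,0)`, the corner of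
    the coordinates of `LandsbergMichalekKoszul.lean` (`algBorderRank_reindex`;
    `algBorderRank_delSlices_revCorner_matMulTensor_three`).
  - Part 2 at that cell (`LandsbergMichalek2018_partTwo`, `LandsbergMichalekKoszul.lean`: the Koszul
    flattening of `⟨3,3,3⟩^{(0,0)}` after the LM projection `K^{3×3} → K⁵` is triangular with at most
    `w · g(0,0) = 3` vanishing diagonal entries, so `90 ≤ 6 · bR(⟨3,3,3⟩^{(0,0)}) + 3`), whence
    `bR(⟨3,3,3⟩^{(0,0)}) ≥ 15` (`fifteen_le_algBorderRank_delSlices_matMulTensor_three`) and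
    **`bR(⟨3,3,3⟩) ≥ 16` over every field** (`LandsbergMichalek_sixteen_le_algBorderRank_matMulTensor_three`;
    the tree's previous best was `15`, `fifteen_le_algBorderRank_matMulTensor_three`).
* `LandsbergGCT2017_borderRank_matMulTensor_three_holds` — the discharge (over `ℂ`), and the
  unconditional readings `borderRank_matMulTensor_three_mem_Icc`,
  `borderRank_matMulTensor_three_window_of_CHL` (the printed window `[17, 20]` given CHL 2023, Thm. 1.1).

## References

* [LandsbergGCT2017] J. M. Landsberg, *Geometry and Complexity Theory*, CUP 2017 — §1.1.14 (p. 20);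
  §5.4.1 Prop. 5.4.1.3; §5.4.5 Thm. 5.4.5.1 and its proof, Parts 1–2 (pp. 133–134 of the held copy).
* [LandsbergMichalek2018] J. M. Landsberg, M. Michałek, IMRN 2018 (15) 4722–4733 = arXiv:1608.07486 —
  Thm. 1.1, §3.
* [Smirnov2013] A. V. Smirnov, Comput. Math. Math. Phys. 53 (2013) 1781–1795 — the approximate
  `⟨3,3,3; 20⟩` algorithm.
* [ConnerHarperLandsberg2023] A. Conner, A. Harper, J. M. Landsberg, Forum Math. Pi 11 (2023) e17 —
  Thm. 1.1 (`R̲(M⟨3⟩) ≥ 17`, the named fact `ConnerHarperLandsberg2023_thm_1_1`, not proved here).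
-/

noncomputable section

open scoped BigOperators Polynomial

namespace Literature.Computability.AlgebraicComplexity

/-! ## `16 ≤ bR(⟨3,3,3⟩)` over every field -/

section Sixteen

variable (K : Type*) [Field K]

/-- **Part 1 of the proof of Landsberg 2017, Thm. 5.4.5.1, for `n = w = 3`, `k = 1`:** killing the
corner direction `(2, 0)` of the first factor costs one unit of border rank,
`bR(⟨3,3,3⟩^{(2,0)}) + 1 ≤ bR(⟨3,3,3⟩)` (the one-cell Young diagram produced by
`matMul_exists_youngDiagram_algBorderRank_le` is closed towards `(n−1, 0) = (2, 0)`, hence is that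
cell). [cite: LandsbergGCT2017, §5.4.5 (proof of Thm. 5.4.5.1, Part 1, case k = 1)] -/
theorem algBorderRank_delSlices_corner_matMulTensor_three :
    algBorderRank (delSlices {((2 : Fin 3), (0 : Fin 3))} (matMulTensor K 3 3 3)) + 1 ≤
      algBorderRank (matMulTensor K 3 3 3) := by
  obtain ⟨S, hcard, hyoung, hle⟩ :=
    matMul_exists_youngDiagram_algBorderRank_le K 3 3 (by norm_num) 1 (by norm_num)
  obtain ⟨b, rfl⟩ := Finset.card_eq_one.1 hcard
  have hb : ((2 : Fin 3), (0 : Fin 3)) ∈ ({b} : Finset (Fin 3 × Fin 3)) :=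
    hyoung b (Finset.mem_singleton_self b) _
      (Fin.le_iff_val_le_val.2 (Nat.lt_succ_iff.1 b.1.isLt)) (Fin.zero_le _)
  rw [Finset.mem_singleton] at hb
  rw [hb]
  -- `delSlices D t` (LandsbergMichalekKoszul) and `zeroSlices D t` (MatMulBorderSubstitution) are the
  -- same function `fun a b c => if a ∈ D then 0 else t a b c`
  exact hle

/-- **The `GL(U)`-symmetry step:** reversing the row index of `U` (on the first factor
`(i, l) ↦ (rev i, l)` and on the second `(i, j) ↦ (rev i, j)`) fixes `⟨3,3,3⟩` and carries the
killed cell `(2, 0)` to `(0, 0)`, so `bR(⟨3,3,3⟩^{(0,0)}) = bR(⟨3,3,3⟩^{(2,0)})`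
(`algBorderRank_reindex`). [cite: LandsbergGCT2017, §5.4.5 (proof of Thm. 5.4.5.1, Part 1: "we may replace [a] by [uⁿ ⊗ v₁]")] -/
theorem algBorderRank_delSlices_revCorner_matMulTensor_three :
    algBorderRank (delSlices {((0 : Fin 3), (0 : Fin 3))} (matMulTensor K 3 3 3)) =
      algBorderRank (delSlices {((2 : Fin 3), (0 : Fin 3))} (matMulTensor K 3 3 3)) := by
  set eι : Fin 3 × Fin 3 ≃ Fin 3 × Fin 3 := Equiv.prodCongr Fin.revPerm (Equiv.refl _) with heι
  have key := algBorderRank_reindex eι eι (Equiv.refl (Fin 3 × Fin 3))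
    (delSlices {((2 : Fin 3), (0 : Fin 3))} (matMulTensor K 3 3 3))
  rw [← key]
  congr 1
  funext a b c
  simp only [delSlices_apply, Finset.mem_singleton, Equiv.refl_apply, heι,
    Equiv.prodCongr_apply, Prod.map, Fin.revPerm_apply, matMulTensor]
  have h1 : (Fin.rev a.1, a.2) = ((2 : Fin 3), (0 : Fin 3)) ↔ a = ((0 : Fin 3), (0 : Fin 3)) := by
    constructor
    · intro h
      have h' := Prod.ext_iff.1 h
      refine Prod.ext ?_ h'.2
      have := h'.1
      rw [Fin.rev_eq_iff] at this
      exact this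
    · rintro rfl
      rfl
  have h2 : (Fin.rev a.1 = Fin.rev b.1) ↔ a.1 = b.1 := Fin.rev_inj
  simp only [h1, h2]

/-- **Part 2 of the proof of Landsberg 2017, Thm. 5.4.5.1, for `n = w = 3` at the corner cell:**
`bR(⟨3,3,3⟩^{(0,0)}) ≥ 15`, from `LandsbergMichalek2018_partTwo` (`w (p+1) C(2p+1,p+1) = 90 ≤
C(2p,p) · bR + w · g(0,0) = 6 · bR + 3`; "each `(i,j) ∈ λ` kills `g(i,j)` terms on the diagonal",
here one per `W`-slice). [cite: LandsbergGCT2017, §5.4.5 (proof of Thm. 5.4.5.1, Part 2)]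
[cite: LandsbergMichalek2018, §3 (Part 2)] -/
theorem fifteen_le_algBorderRank_delSlices_matMulTensor_three :
    15 ≤ algBorderRank (delSlices {((0 : Fin 3), (0 : Fin 3))} (matMulTensor K 3 3 3)) := by
  have h := LandsbergMichalek2018_partTwo K 2 3 {((0 : Fin 3), (0 : Fin 3))}
  rw [Finset.sum_singleton] at h
  have h1 : (2 * 2 + 1).choose (2 + 1) = 10 := by decide
  have h2 : (2 * 2).choose 2 = 6 := by decide
  have h3 : lmG 2 ((0 : Fin 3), (0 : Fin 3)) = 1 := by decide
  rw [h1, h2, h3] at h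
  change 3 * ((2 + 1) * 10) ≤
    6 * algBorderRank (delSlices {((0 : Fin 3), (0 : Fin 3))} (matMulTensor K 3 3 3)) + 3 * 1 at h
  omega

/-- **`16 ≤ bR(⟨3,3,3⟩)` over every field** (Landsberg–Michałek: Landsberg 2017, Thm. 5.4.5.1 =
LM 2018, Thm. 1.1 with `n = w = 3`, `m = 1`, `2·9 − 3 + 1 − ⌊3 · C(3,0)/C(4,2)⌋ = 16`; first proved
as `R̲(M⟨n⟩) ≥ 2n² − n + 1` in LM's 2017 SIAGA paper). Assembly of the three steps above:
`bR ≥ bR(⟨3,3,3⟩^{(2,0)}) + 1 = bR(⟨3,3,3⟩^{(0,0)}) + 1 ≥ 16`.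
[cite: LandsbergGCT2017, Thm. 5.4.5.1 (n = w = 3, m = 1) and §1.1.14 (p. 20)]
[cite: LandsbergMichalek2018, Thm. 1.1] -/
theorem LandsbergMichalek_sixteen_le_algBorderRank_matMulTensor_three :
    16 ≤ algBorderRank (matMulTensor K 3 3 3) := by
  have h1 := algBorderRank_delSlices_corner_matMulTensor_three K
  have h2 := algBorderRank_delSlices_revCorner_matMulTensor_three K
  have h3 := fifteen_le_algBorderRank_delSlices_matMulTensor_three K
  omega

end Sixteen

/-! ## The discharge and its readings -/

/-- **Landsberg 2017, §1.1.14: `16 ≤ R̲(M⟨3⟩) ≤ 20`** — the named fact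
`LandsbergGCT2017_borderRank_matMulTensor_three` DISCHARGED: the lower half by Landsberg–Michałek's
border substitution + Koszul flattening (`LandsbergMichalek_sixteen_le_algBorderRank_matMulTensor_three`),
the upper half by Smirnov's explicit approximate algorithm
(`Smirnov2013_algBorderRank_matMulTensor_three_le`). [cite: LandsbergGCT2017, §1.1.14 (p. 20)] -/
theorem LandsbergGCT2017_borderRank_matMulTensor_three_holds :
    LandsbergGCT2017_borderRank_matMulTensor_three :=
  ⟨LandsbergMichalek_sixteen_le_algBorderRank_matMulTensor_three ℂ,
    Smirnov2013_algBorderRank_matMulTensor_three_le ℂ⟩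

/-- The proved window as a membership: `bR(⟨3,3,3⟩) ∈ [16, 20]` over `ℂ`.
[cite: LandsbergGCT2017, §1.1.14 (p. 20)] -/
theorem borderRank_matMulTensor_three_mem_Icc :
    algBorderRank (matMulTensor ℂ 3 3 3) ∈ Set.Icc 16 20 :=
  LandsbergGCT2017_borderRank_matMulTensor_three_holds

/-- With the upper half proved, the sharper printed window `R̲(M⟨3⟩) ∈ [17, 20]` rests only on
Conner–Harper–Landsberg 2023, Thm. 1.1 (border apolarity, the named fact
`ConnerHarperLandsberg2023_thm_1_1`). [cite: ConnerHarperLandsberg2023, Thm. 1.1] -/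
theorem borderRank_matMulTensor_three_window_of_CHL (h : ConnerHarperLandsberg2023_thm_1_1) :
    17 ≤ algBorderRank (matMulTensor ℂ 3 3 3) ∧ algBorderRank (matMulTensor ℂ 3 3 3) ≤ 20 :=
  borderRank_matMulTensor_three_window h LandsbergGCT2017_borderRank_matMulTensor_three_holds

end Literature.Computability.AlgebraicComplexity

end
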